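import Summits.ResolutionOfSingularities.ResolutionOfSingularities.Theorems.PurelyInseparableDim4ChartAtlasSNCFarChartPairs
import Summits.ResolutionOfSingularities.ResolutionOfSingularities.Theorems.PurelyInseparableDim4ChartAtlasSNCGoodFarEscapingCharts
import HarnessLib

/-!
# Purely inseparable four-folds `z^p + F(x₁, …, x₄)`: the transformed boundary of a PAIR-LIST of old members (parallel members allowed), read on the
# re-centred `x_j`-chart, escaping case `j ∉ S'` (S3-N2 positive side; cell `res-dim4-pi`, typ-2 g6)

[OURS · counted 0] (D-0157 DOOR 2; DR-157-C; typ-2 HANDOFF OPEN item «parallel members of equal index»). p703421 read the old boundary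
`[(xᵢ + cᵢ)·𝒪 : i ∈ ms] ++ [(xᵢ + dᵢ)·𝒪 : i ∈ fs]` (one member per index). Here the old boundary is ANY list of pairs
`E = [(x_{i} + c)·𝒪 : (i, c) ∈ L]` — NEAR when `i ∈ S ∧ c = 0`, FAR when `i ∈ S ∧ c ≠ 0`, TRANSVERSAL when `i ∉ S`; parallel members `(i, c), (i, c')`
allowed. PROVED here (no `sorry`, no new axiom): `hasSNCWith_boundary_readings_translate_chart_pairs` (chart `x_j`, via p709429), under pairwise distinct active
far heights phrased on the pairs; the shear charts are the companion file `…GoodFarPairsCharts`. Nothing here is a statement about resolution of singularities in dimension ≥ 4 / characteristic `p` (NOT proved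
anywhere in this programme). bears_on: LADDER-RESOLUTION:D157-DOOR2 (res-dim4-pi). Supports stmt-ResolutionOfSingularities-16155 (helper).
-/

-- every declaration of this summit lives under `Summit.ResolutionOfSingularities.ResolutionOfSingularities`
-- (summit = problem), which the duplicate-namespace linter flags; house convention (cf. the Target file).
set_option linter.dupNamespace false

noncomputable section

open MvPolynomial CategoryTheory AlgebraicGeometry Opposite TopologicalSpace
open AlgebraicGeometry.Scheme.IdealSheafData (ofIdealTop)

namespace Summit.ResolutionOfSingularities.ResolutionOfSingularities.Theorems.PIDim4

open Literature.AlgebraicGeometry.Resolution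
open Literature.AlgebraicGeometry.Resolution.AffinePointBlowup (P A γ coord Wtop ξ)

namespace ChartDictionary

variable {K : Type} [Field K]

section TranslateChart

variable {S S' : Finset (Fin 4)} {j : Fin 4} {b : Fin 4 → K} {Θ : A 4 K ≃ₐ[K] A 4 K} {W : Scheme.{0}} {π : W ⟶ P 4 K}

/-- **PAIR-LIST BOUNDARY ON THE RE-CENTRED `x_j`-CHART: snc with the escaping centre** (`j ∉ S'`) when no far `{x_j = -c}` has the height of an active far
quadric `(i, d)` (`d ≠ bᵢ·c`) and no two distinct active far pairs share a height (`d·b_k ≠ d'·bᵢ`). -/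
theorem hasSNCWith_boundary_readings_translate_chart_pairs (hj : j ∈ S) (hjS' : j ∉ S') (hbj : b j = 0) (L : List (Fin 4 × K))
    (hs : ∀ i : Fin 4, Θ (X i.succ) = X i.succ + C (b i))
    (hH1 : ∀ ic ∈ L, ic.1 ∈ S → ic.2 ≠ 0 → ic.1 ∈ S' → b ic.1 ≠ 0 → ∀ c : K, (j, c) ∈ L → c ≠ 0 → ic.2 ≠ b ic.1 * c)
    (hH2 : ∀ ic ∈ L, ∀ kd ∈ L, ic ≠ kd → ic.1 ∈ S → kd.1 ∈ S → ic.2 ≠ 0 → kd.2 ≠ 0 → ic.1 ∈ S' → kd.1 ∈ S' → b ic.1 ≠ 0 → b kd.1 ≠ 0 →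
      ic.2 * b kd.1 ≠ kd.2 * b ic.1)
    (hπ : IsBlowup π (AffineCoordBlowup.𝓘Λ 4 K (insert 0 (Fin.succ '' (S : Set (Fin 4)))))) :
    haveI : IsIso (CommRingCat.ofHom (Θ : A 4 K →+* A 4 K)) := (inferInstance : IsIso Θ.toRingEquiv.toCommRingCatIso.hom)
    HasSNCWith (((L.map fun ic => ofIdealTop (Ideal.span {(γ 4 K).symm (X ic.1.succ + C ic.2)})).map
        (strictTransformIdeal π (AffineCoordBlowup.𝓘Λ 4 K (insert 0 (Fin.succ '' (S : Set (Fin 4)))))) ++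
        [(AffineCoordBlowup.𝓘Λ 4 K (insert 0 (Fin.succ '' (S : Set (Fin 4))))).comap π]).map
        (·.comap (Spec.map (CommRingCat.ofHom (Θ : A 4 K →+* A 4 K)) ≫ AffineCoordBlowup.chartImm hπ (succ_mem_centreVars hj))))
      (AffineCoordBlowup.𝓘Λ 4 K (insert 0 (Fin.succ '' (S' : Set (Fin 4))))) := by
  classical
  haveI : IsIso (CommRingCat.ofHom (Θ : A 4 K →+* A 4 K)) := (inferInstance : IsIso Θ.toRingEquiv.toCommRingCatIso.hom)
  -- hyperplane data: `E₁`; far `{x_j = -c}` ↦ `(j⁺, c)`; near `i ∈ S ∖ j` ↦ `(i⁺, bᵢ)`; transversal `i ∉ S` ↦ `(i⁺, bᵢ + c)`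
  let H : Finset (Fin (4 + 1) × K) := insert (j.succ, (0 : K))
    (((L.toFinset.filter fun ic => ic.1 = j).image fun ic => (j.succ, ic.2)) ∪
      ((L.toFinset.filter fun ic => ic.1 ∈ S ∧ ic.1 ≠ j ∧ ic.2 = 0).image fun ic => (ic.1.succ, b ic.1)) ∪
      ((L.toFinset.filter fun ic => ic.1 ∉ S).image fun ic => (ic.1.succ, b ic.1 + ic.2)))
  let FQ : Finset (Fin 4 × K) := L.toFinset.filter fun ic => ic.1 ∈ S ∧ ic.1 ≠ j ∧ ic.2 ≠ 0
  have hHmem : ∀ ka, ka ∈ H → ka = (j.succ, (0 : K)) ∨ (∃ c, (j, c) ∈ L ∧ ka = (j.succ, c)) ∨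
      (∃ i, (i, (0 : K)) ∈ L ∧ i ∈ S ∧ i ≠ j ∧ ka = (i.succ, b i)) ∨ ∃ ic ∈ L, ic.1 ∉ S ∧ ka = (ic.1.succ, b ic.1 + ic.2) := by
    intro ka hka
    simp only [H, Finset.mem_insert, Finset.mem_union, Finset.mem_image, Finset.mem_filter, List.mem_toFinset] at hka
    rcases hka with h | ((⟨ic, ⟨hic, hj'⟩, rfl⟩ | ⟨ic, ⟨hic, hiS, hij, hc0⟩, rfl⟩) | ⟨ic, ⟨hic, hiS⟩, rfl⟩)
    · exact Or.inl h
    · exact Or.inr (Or.inl ⟨ic.2, by rw [← hj']; exact hic, rfl⟩)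
    · exact Or.inr (Or.inr (Or.inl ⟨ic.1, by rw [← hc0]; exact hic, hiS, hij, rfl⟩))
    · exact Or.inr (Or.inr (Or.inr ⟨ic, hic, hiS, rfl⟩))
  have hFQ : ∀ id, id ∈ FQ ↔ id ∈ L ∧ id.1 ∈ S ∧ id.1 ≠ j ∧ id.2 ≠ 0 := fun id => by
    simp only [FQ, Finset.mem_filter, List.mem_toFinset]
  refine hasSNCWith_𝓘Λ_of_forall_mem_far_pairs (K := K) (T := S') (j := j) (b := b) hjS' H FQ
    (fun id hid => ⟨((hFQ id).mp hid).2.2.1, ((hFQ id).mp hid).2.2.2⟩) ?_ ?_ ?_ ?_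
  · -- (C1)
    intro id hid a ha
    obtain ⟨-, hiS, hij, -⟩ := (hFQ id).mp hid
    rcases hHmem _ ha with e | ⟨c, -, e⟩ | ⟨i, -, -, -, e⟩ | ⟨ic, -, hicS, e⟩
    · exact absurd (Fin.succ_injective _ (Prod.mk.inj e).1) hij
    · exact absurd (Fin.succ_injective _ (Prod.mk.inj e).1) hij
    · obtain ⟨e1, e2⟩ := Prod.mk.inj e
      rw [e2, Fin.succ_injective _ e1]
    · exact absurd ((Fin.succ_injective _ (Prod.mk.inj e).1) ▸ hiS) hicS
  · -- (C2)
    intro id hid hiS' hbi a ha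
    obtain ⟨hidL, hiS, hij, hd⟩ := (hFQ id).mp hid
    rcases hHmem _ ha with e | ⟨c, hcL, e⟩ | ⟨i, -, -, hij', e⟩ | ⟨ic, -, hicS, e⟩
    · rw [(Prod.mk.inj e).2, zero_mul]; exact hd.symm
    · rw [(Prod.mk.inj e).2]
      by_cases hc : c = 0
      · rw [hc, zero_mul]; exact hd.symm
      · rw [mul_comm]; exact (hH1 id hidL hiS hd hiS' hbi c hcL hc).symm
    · exact absurd (Fin.succ_injective _ (Prod.mk.inj e).1).symm hij'
    · exact absurd ((Fin.succ_injective _ (Prod.mk.inj e).1) ▸ hj) hicS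
  · -- (C3)
    intro id hid kd hkd hne hiS' hkS' hbi hbk
    obtain ⟨hidL, hiS, -, hd⟩ := (hFQ id).mp hid
    obtain ⟨hkdL, hkS, -, hd'⟩ := (hFQ kd).mp hkd
    exact hH2 id hidL kd hkdL hne hiS hkS hd hd' hiS' hkS' hbi hbk
  · -- the members
    intro D hD
    rw [List.map_append, List.map_map, List.map_map, List.mem_append, List.mem_map, List.map_singleton, List.mem_singleton] at hD
    rcases hD with ⟨ic, hic, rfl⟩ | rfl
    · simp only [Function.comp_apply]
      by_cases hij : ic.1 = j
      · by_cases hc : ic.2 = 0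
        · left
          have e1 : ic = (j, 0) := Prod.ext hij hc
          rw [e1, C_0, add_zero, Scheme.IdealSheafData.comap_comp, show (γ 4 K).symm (X j.succ) = coord 4 K j.succ from rfl,
            strictTransformIdeal_hyperplane_self_comap_chartImm hj hπ, Scheme.IdealSheafData.comap_top]
        · right; left
          refine ⟨(j.succ, ic.2), Finset.mem_insert_of_mem (Finset.mem_union_left _ (Finset.mem_union_left _
            (Finset.mem_image.mpr ⟨ic, Finset.mem_filter.mpr ⟨List.mem_toFinset.mpr hic, hij⟩, rfl⟩))), ?_⟩
          have e1 : ic = (j, ic.2) := Prod.ext hij rfl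
          rw [e1]
          change (strictTransformIdeal π _ (ofIdealTop (Ideal.span {(γ 4 K).symm (X j.succ + C ic.2)}))).comap _ = _
          rw [comap_recenter_chart_strictTransform_far_self hj hc hs hπ, hbj, zero_add]
      · by_cases hiS : ic.1 ∈ S
        · by_cases hc : ic.2 = 0
          · right; left
            refine ⟨(ic.1.succ, b ic.1), Finset.mem_insert_of_mem (Finset.mem_union_left _ (Finset.mem_union_right _
              (Finset.mem_image.mpr ⟨ic, Finset.mem_filter.mpr ⟨List.mem_toFinset.mpr hic, hiS, hij, hc⟩, rfl⟩))), ?_⟩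
            rw [hc, C_0, add_zero, Scheme.IdealSheafData.comap_comp, show (γ 4 K).symm (X ic.1.succ) = coord 4 K ic.1.succ from rfl,
              strictTransformIdeal_hyperplane_comap_chartImm hj hij hπ, show coord 4 K ic.1.succ = (γ 4 K).symm (X ic.1.succ) from rfl,
              comap_ofIdealTop_span_γ_symm, RingHom.coe_coe, hs ic.1]
          · right; right
            refine ⟨ic, (hFQ ic).mpr ⟨hic, hiS, hij, hc⟩, ?_⟩
            rw [comap_recenter_chart_strictTransform_far hj hiS hij hc hs hπ, hbj, C_0, add_zero]
        · right; left
          refine ⟨(ic.1.succ, b ic.1 + ic.2), Finset.mem_insert_of_mem (Finset.mem_union_right _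
            (Finset.mem_image.mpr ⟨ic, Finset.mem_filter.mpr ⟨List.mem_toFinset.mpr hic, hiS⟩, rfl⟩)), ?_⟩
          have hC : Θ (C ic.2) = C ic.2 := Θ.commutes ic.2
          rw [Scheme.IdealSheafData.comap_comp, strictTransformIdeal_translate_comap_chartImm hj hiS ic.2 hπ, comap_ofIdealTop_span_γ_symm,
            RingHom.coe_coe, map_add, hs ic.1, hC, add_assoc, ← C_add]
    · right; left
      refine ⟨(j.succ, 0), Finset.mem_insert_self _ _, ?_⟩
      rw [Scheme.IdealSheafData.comap_comp, comap_𝓘Λ_chartImm hj hπ, show coord 4 K j.succ = (γ 4 K).symm (X j.succ) from rfl,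
        comap_ofIdealTop_span_γ_symm, RingHom.coe_coe, hs j, hbj]

end TranslateChart


end ChartDictionary

end Summit.ResolutionOfSingularities.ResolutionOfSingularities.Theorems.PIDim4

end
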